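import Literature.AlgebraicGeometry.Frobenioids.ArithmeticRealificationInstance
import Literature.AlgebraicGeometry.Frobenioids.Prop55iiiRlfModel
import Literature.AlgebraicGeometry.Frobenioids.ModelFrobenioidDivision
import Literature.AlgebraicGeometry.Frobenioids.PreFrobenioidDataOfFunctor
import HarnessLib

/-!
# Frobenioids I, Theorem 6.4 (i)/(ii)/(iv): Frobenius-trivial objects of THE realified arithmetic Frobenioid
# `C_{K/F}^rlf` — existence over every `Spec L`, and preservation under a functor lying over `Ψ^Base` that
# preserves Frobenius degrees and transports divisors (the `Ψ^rlf` of Cor. 5.4)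

Mochizuki, *The geometry of Frobenioids I: the general theory*, Kyushu J. Math. **62** (2008) 293–400, §6,
Thm. 6.4 (i) p. 114 l. 21–23 ("if `A ∈ Ob(C^rlf)` is a Frobenius-trivial object that projects to the object of `D`
determined by a finite extension `L ⊆ F̃` of `F` …"), (ii) p. 114 ("for all Frobenius-trivial `A₁ ∈ Ob(C₁)`, `A₂ ∈
Ob(C₂)` such that `A₂ = Ψ^rlf(A₁)` [where we recall that `Ψ^rlf` preserves Frobenius-trivial objects — cf. (i);
Corollary 4.11, (iv)]"), and the proof of Thm. 5.2, p. 101 ("the objects `A = (A_D, α)` such that `α = 0` are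
Frobenius-trivial"). [cite: MochizukiFrdI2008, Thm. 6.4 (ii) p.114]

PROOF-ONLY (cell abc-iut, row «T64-ASSEMBLIES» step 3 = the at-the-data composition of the schema `Thm64iv`; seat
abc-iut-L1-t3; 0 `def`, no instance, no notation).  Two inputs of the binder `gen` of abc-iut-L1-t3's
`Thm64iv_of_generatorReadings` (`ArithmeticFrobenioidThm64ivSchema.lean`), at THE realified arithmetic Frobenioid
`C_{K/F}^rlf = PreFrobenioid.rlf (ModelFrobenioid.toElem Φ B Div_B) hΦ` with THE operations of abc-iut-L1-d2's
`arithRealification hΦ` (`= FrdI.Cor54Sub.rlfData … hΦ`):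
* `arithRealification_exists_isFrobeniusTrivial_over` — over every `X = Spec L ∈ Ob(D)` there is a Frobenius-trivial
  object `A = (X, 0)` of `C_{K/F}^rlf` with `Base A = X` (abc-iut-L1-t5's `ModelFrobenioid.isFrobeniusTrivial_of_cls_eq_one`;
  `ℝ · Φ^birat` is group-like, abc-iut-L1-d2's `RealificationData.realSpan_toMonoid_isGroupLike`);
* `arithRealification_isFrobeniusTrivial_map` — "`Ψ^rlf` preserves Frobenius-trivial objects": a functor
  `Ψ^rlf : C₁^rlf → C₂^rlf` lying over `Ψ^Base` (`ηrlf`), preserving Frobenius degrees and carrying `Div` through an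
  isomorphism of realified divisor monoids over `Ψ^Base` (the conclusion shape of abc-iut-L1-d7's
  `exists_rlfTransport_of_cor411iv`, [FrdI] Cor. 5.4 at `C_{K/F}`) maps Frobenius-trivial objects to Frobenius-trivial
  objects — every morphism of the model Frobenioid `C₂^rlf` being co-angular (abc-iut-L1-t5's `ModelFrobenioid.isCoAngular`).
Nothing here bears on [IUTchIII] Cor. 3.12; no statement of the paper is strengthened.
-/

noncomputable section

namespace Literature.AlgebraicGeometry.Frobenioids

open CategoryTheory Opposite NumberField Literature.AnabelianGeometry.EtaleTheta

/-! ### Frobenius-trivial objects over every base object -/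

section OneSide

variable {F : Type} [Field F] [NumberField F] {K : Type} [Field K] [Algebra F K]
  (hΦ : PreFrobenioid.IsPerfFactorialOn (arithDivisorFunctor F K))

/-- The operations of THE `ArithRealification` read Frobenius-triviality as abc-iut-found's functor-style notion for the
structure functor `C^rlf → F_{Φ^rlf}`. [cite: MochizukiFrdI2008, Def. 1.2 (iv) p.22] -/
theorem arithRealification_isFrobeniusTrivial_iff
    (A : PreFrobenioid.rlf (ModelFrobenioid.toElem (arithDivisorFunctor F K) (unitsFunctor F K) (divNatTrans F K)) hΦ) :
    (arithRealification hΦ).ops.IsFrobeniusTrivial A ↔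
      PreFrobenioid.IsFrobeniusTrivial
        (PreFrobenioid.rlfToElem
          (ModelFrobenioid.toElem (arithDivisorFunctor F K) (unitsFunctor F K) (divNatTrans F K)) hΦ) A :=
  PreFrobenioidData.ofFunctor_isFrobeniusTrivial _ A

/-- **"The objects `(A_D, 0)` are Frobenius-trivial"** (proof of Thm. 5.2, p. 101) in THE realified arithmetic
Frobenioid: the object `(X, 0)` of `C_{K/F}^rlf` is Frobenius-trivial for the operations of `arithRealification hΦ`.
[cite: MochizukiFrdI2008, Thm. 5.2 p.101] -/
theorem arithRealification_isFrobeniusTrivial_zero (X : FinSubextCat F K) :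
    (arithRealification hΦ).ops.IsFrobeniusTrivial
      (⟨X, 1⟩ : PreFrobenioid.rlf
        (ModelFrobenioid.toElem (arithDivisorFunctor F K) (unitsFunctor F K) (divNatTrans F K)) hΦ) :=
  (arithRealification_isFrobeniusTrivial_iff hΦ _).mpr
    (ModelFrobenioid.isFrobeniusTrivial_of_cls_eq_one
      (RealificationData.realSpan_toMonoid_isGroupLike _ _) _ rfl)

/-- **Over every `X = Spec L ∈ Ob(D)` there is a Frobenius-trivial object `A` of `C_{K/F}^rlf` with `Base A = X`**
(the objects Thm. 6.4 (i) last sentence / (ii) speak about). [cite: MochizukiFrdI2008, Thm. 6.4 (i) p.114] -/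
theorem arithRealification_exists_isFrobeniusTrivial_over (X : FinSubextCat F K) :
    ∃ A : PreFrobenioid.rlf
        (ModelFrobenioid.toElem (arithDivisorFunctor F K) (unitsFunctor F K) (divNatTrans F K)) hΦ,
      A.base = X ∧ (arithRealification hΦ).ops.IsFrobeniusTrivial A :=
  ⟨⟨X, 1⟩, rfl, arithRealification_isFrobeniusTrivial_zero hΦ X⟩

/-- Every morphism of `C_{K/F}^rlf` is co-angular (a model Frobenioid with group-like rational-function monoid
`ℝ · Φ^birat`), for the operations of `arithRealification hΦ`. [cite: MochizukiFrdI2008, Thm. 5.2 p.101] -/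
theorem arithRealification_isCoAngular
    {A B : PreFrobenioid.rlf (ModelFrobenioid.toElem (arithDivisorFunctor F K) (unitsFunctor F K) (divNatTrans F K)) hΦ}
    (φ : A ⟶ B) : (arithRealification hΦ).ops.IsCoAngular φ :=
  (PreFrobenioidData.ofFunctor_isCoAngular _ φ).mpr
    (ModelFrobenioid.isCoAngular (RealificationData.realSpan_toMonoid_isGroupLike _ _) φ)

end OneSide

/-! ### `Ψ^rlf` preserves Frobenius-trivial objects -/

section TwoSides

variable {F₁ : Type} [Field F₁] [NumberField F₁] {K₁ : Type} [Field K₁] [Algebra F₁ K₁]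
  {F₂ : Type} [Field F₂] [NumberField F₂] {K₂ : Type} [Field K₂] [Algebra F₂ K₂]
  (hΦ₁ : PreFrobenioid.IsPerfFactorialOn (arithDivisorFunctor F₁ K₁))
  (hΦ₂ : PreFrobenioid.IsPerfFactorialOn (arithDivisorFunctor F₂ K₂))
  (ΨBase : FinSubextCat F₁ K₁ ⥤ FinSubextCat F₂ K₂)
  (Erlf : PreFrobenioidData.DivisorMonoidIsoOverBase (arithRealification hΦ₁).ops (arithRealification hΦ₂).ops ΨBase)
  (Ψrlf : PreFrobenioid.rlf
      (ModelFrobenioid.toElem (arithDivisorFunctor F₁ K₁) (unitsFunctor F₁ K₁) (divNatTrans F₁ K₁)) hΦ₁ ⥤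
    PreFrobenioid.rlf
      (ModelFrobenioid.toElem (arithDivisorFunctor F₂ K₂) (unitsFunctor F₂ K₂) (divNatTrans F₂ K₂)) hΦ₂)
  (ηrlf : Ψrlf ⋙ (arithRealification hΦ₂).ops.base ≅ (arithRealification hΦ₁).ops.base ⋙ ΨBase)
  (hdeg : ∀ ⦃A B⦄ (φ : A ⟶ B), (arithRealification hΦ₂).ops.degFr (Ψrlf.map φ) = (arithRealification hΦ₁).ops.degFr φ)
  (hdiv : ∀ ⦃A B⦄ (φ : A ⟶ B),
    (arithRealification hΦ₂).ops.div (Ψrlf.map φ) =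
      (arithRealification hΦ₂).ops.pull (ηrlf.hom.app A)
        (Erlf.iso ((arithRealification hΦ₁).ops.base.obj A) ((arithRealification hΦ₁).ops.div φ)))

include ηrlf in
/-- A functor over `Ψ^Base` maps base-identity endomorphisms to base-identity endomorphisms.
[cite: MochizukiFrdI2008, Cor. 4.11 (iv) p.92] -/
theorem arithRealification_isBaseIdentity_map
    {A : PreFrobenioid.rlf (ModelFrobenioid.toElem (arithDivisorFunctor F₁ K₁) (unitsFunctor F₁ K₁) (divNatTrans F₁ K₁)) hΦ₁}
    (φ : A ⟶ A) (hφ : (arithRealification hΦ₁).ops.IsBaseIdentity φ) :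
    (arithRealification hΦ₂).ops.IsBaseIdentity (Ψrlf.map φ) := by
  have hnat := ηrlf.hom.naturality φ
  have h1 : ((arithRealification hΦ₁).ops.base ⋙ ΨBase).map φ = 𝟙 _ := by
    show ΨBase.map ((arithRealification hΦ₁).ops.base.map φ) = 𝟙 _
    rw [show (arithRealification hΦ₁).ops.base.map φ = 𝟙 _ from hφ, ΨBase.map_id]
  rw [h1, Category.comp_id] at hnat
  have h2 : (Ψrlf ⋙ (arithRealification hΦ₂).ops.base).map φ = 𝟙 _ := by
    rw [← cancel_mono (ηrlf.hom.app A), hnat, Category.id_comp]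
  exact h2

include ηrlf hdeg hdiv in
/-- **`Ψ^rlf` preserves Frobenius-trivial objects** ("cf. (i); Corollary 4.11, (iv)", Thm. 6.4 (ii) p. 114): for a
functor `Ψ^rlf : C₁^rlf → C₂^rlf` over `Ψ^Base` preserving Frobenius degrees and carrying `Div` through an isomorphism
`Φ₁^rlf ⥲ Φ₂^rlf` over `Ψ^Base`, the image of a Frobenius-trivial object is Frobenius-trivial: the section
`ζ : ℕ_{≥1} → End(A)` of base-identity endomorphisms of Frobenius type goes to such a section of `End(Ψ^rlf A)`
(degrees by `hdeg`; base-identity by `ηrlf`; isometry because `Div` is transported by homomorphisms; co-angularity is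
automatic in `C₂^rlf`). [cite: MochizukiFrdI2008, Thm. 6.4 (ii) p.114] -/
theorem arithRealification_isFrobeniusTrivial_map
    {A : PreFrobenioid.rlf (ModelFrobenioid.toElem (arithDivisorFunctor F₁ K₁) (unitsFunctor F₁ K₁) (divNatTrans F₁ K₁)) hΦ₁}
    (hA : (arithRealification hΦ₁).ops.IsFrobeniusTrivial A) :
    (arithRealification hΦ₂).ops.IsFrobeniusTrivial (Ψrlf.obj A) := by
  obtain ⟨ζ, hζ⟩ := hA
  refine ⟨(Ψrlf.mapEnd A).comp ζ, fun n => ⟨?_, ?_, ⟨⟨arithRealification_isCoAngular hΦ₂ _, ?_⟩, ?_⟩⟩⟩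
  · -- Frobenius degree
    show (arithRealification hΦ₂).ops.degFr (Ψrlf.map (ζ n)) = n
    rw [hdeg, (hζ n).1]
  · -- base-identity
    exact arithRealification_isBaseIdentity_map hΦ₁ hΦ₂ ΨBase Ψrlf ηrlf (ζ n) (hζ n).2.1
  · -- isometry: `Div(Ψ^rlf ζ_n) = (η_A)^* Ψ^Φ(Div ζ_n) = (η_A)^* Ψ^Φ(0) = 0`
    show (arithRealification hΦ₂).ops.div (Ψrlf.map (ζ n)) = 1
    have hiso : (arithRealification hΦ₁).ops.div (ζ n) = 1 := (hζ n).2.2.1.2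
    rw [hdiv, hiso, map_one]
    exact map_one _
  · -- base-isomorphism
    show IsIso ((arithRealification hΦ₂).ops.base.map (Ψrlf.map (ζ n)))
    have h : (arithRealification hΦ₂).ops.base.map (Ψrlf.map (ζ n)) = 𝟙 _ :=
      arithRealification_isBaseIdentity_map hΦ₁ hΦ₂ ΨBase Ψrlf ηrlf (ζ n) (hζ n).2.1
    rw [h]
    infer_instance

end TwoSides

end Literature.AlgebraicGeometry.Frobenioids

end
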